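import Summits.QuantumFields.BalabanUV.T4Continuum.Support.NE9CurveSpeciesCoupling
import Summits.QuantumFields.BalabanUV.T4Continuum.Support.NE9CurveSpeciesMargProj
import Summits.QuantumFields.BalabanUV.T4Continuum.Support.NE9RemainderSpeciesCouplingEnd

/-!
# NE9CurveSpeciesCouplingEnd — the END-M read-out face AT THE CURVE SPECIES with leaf A3 DISCHARGED: rows MP ∕ S-sum ∕ S5 ∕ A3
# all by name, the two per-piece coupling responses `hrespE` ∕ `hrespA` PRODUCED (cell `pub-balaban`, T4-DAG §2 node U3 ∕ §6 NE9;
# NE9 formalisation swarm, unit `b2b-balaban-t4-ne9-formalise-leaf-05` gen 5; sequel of crew row (w20) «A3-REM twin on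
# `CurData`» (OWNER t4-ne9-p1 g25, CLAIMS.log l.9603; CLAIM l.10038 ∕ l.10170) — the curve twin of leaf-09-g5's A3-REM-END
# `NE9RemainderSpeciesCouplingEnd` p213409, on leaf-04-g6's (w21)-MP face `NE9CurveSpeciesMargProj` p214225)

HONEST FRAMING (T4-DAG PAGE 1).  Rung (B)+1 of the FINITE-VOLUME T⁴ programme — existence AND uniqueness of the ε → 0 limit
of gauge-invariant observables on a fixed torus; NOT infinite volume, NOT a mass gap, NOT the Clay problem.  NE9
(`T4OutputRate.NE9` ∧ `FadingMemory`) is a cell NEW ESTIMATE, NOT PRINTED; this file discharges ONE displayed binder pair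
(leaf A3's `hrespE` ∕ `hrespA`) of a landed END face at FORM level and NOTHING of Bałaban's («NE9 ⇐ the named binders»); spine
0∕9; 0∕18 skeleton leaves instantiated on Bałaban's objects (O-NE9-1).  HONEST DEPENDENCY (cell line, verbatim): continuum YM
on T⁴ ⇐ BetaPertH ∧ nine spine estimates (0/9 proved); BetaPertH ⇐ (D1) ∧ (D4) ∧ CAP+tail; G-an2-4 gates asym, D1 and NE2/3/4.
[I] = [Balaban1987RG1] (CMP **109**), [II] = [Balaban1988RG2Cluster] (CMP **116**) are quoted for TYPES only (ABSOLUTE RULE: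
nothing printed in the audited series is asserted).  No `def`, no Prop-valued definition; `FlowStep.BetaPertH`, (B), (B^μ) do
not occur.

WHERE THIS SITS.  Three landed pieces meet here:
* leaf-04-g6's `NE9CurveSpeciesMargProj.termSize_ne9_and_fadingMemory_cur_margProj_cpieceForm` ((w21)-MP) — the END-M read-out
  face at the CURVE species `P := Dc.toC` with rows MP ∕ S-sum ∕ S5 DISCHARGED (S5 := the owner's `pieceBoundOnG_cur`) and EXACTLY
  TWO leaf-A3 binders left displayed: the per-piece coupling responses `hrespE` (of the terms) and `hrespA` (of the scale-wise
  multiples `U X ↦ c(scale X)·A U X` of the marginal direction);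
* this lineage's `NE9CurveSpeciesCoupling.cpieceResponse_cur` ((w20) species half) — the PRODUCER of `hrespE` from analyticity +
  the (1.18)-type size `TermSize` + `hhalf` + three displayed SLICE-CURVE binders (c1) joint continuity on (contours) × {|τ| = 1},
  (c2) coupling-Lipschitz displacement `clip·(R_X∕2)·|g k − g′ k|` and (c3) room `R_X∕2` on the inner disc `|τ| < (2c_dirℓ)⁻¹`
  (TYPE: [I] Lemma 4 (3.53) p. 280, [II] (1.21)–(1.23) p. 7);
* leaf-09-g5's `NE9RemainderSpeciesCouplingEnd.termSize_const_smul` — the (1.18)-type size of a constant multiple of `A`.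
THIS FILE: §1 **`cpieceResponseA_cur`** PRODUCES `hrespA` for the curve species: at a source `x` the piece reads the family on the
two copies of `x` only (`pieceLocal_cur`), so the scale-wise multiple may be replaced by the CONSTANT multiple `c(scale x) • A`,
analytic (`smul_mem_analyticClass`) and of size `|c(scale x)|·aA`; `cpieceResponse_cur` at that coupling-independent family gives
the bound with `qcA := 64·cA·aA` and `|c(scale x)|` in front — no homogeneity of the (1.23)-functional is used.  §2
**`termSize_ne9_and_fadingMemory_cur_margProj_cpieceForm_A3`** = (w21)-MP §1 APPLIED BY NAME with `hrespE := cpieceResponse_cur` and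
`hrespA := §1`; the one wrinkle — `cpieceResponse_cur` wants `TermSize E W κ N` as INPUT while the face OUTPUTS it — is met exactly
as in A3-REM-END: `TermSize` is derived FIRST through END-M's own internal route (`termSize_of_recursion_vacSub` ∘
`channelSizeNN_of_perStepNN` ∘ `channelStepSum_compProj` ∕ `channelSizeAtStepNN_compProj` ∘ `projScaleComm_margProj` ∕
`projSize_margProj`, MP's `ProjInto` := `projInto_margProj_analytic`, S-sum ∕ S5 on the marginal-free class from `pieceZero_cur` ∕
`pieceLocal_cur` ∕ `csrcScale_cur` ∕ `pieceBoundOnG_cur` + `pieceBoundOnG_mono`) — one-history binders only, no circularity.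
AFTER THIS FACE the channel side displays ONLY: O1-type data; the species' `CurData.Admissible` (Lemma 4 TYPE, radii, gain, G1)
and `LevelCountsG` ((1.26)–(1.28) numerals); `Adm ⊆ analyticClass` with S1; AW; RO and the S-closure `hS`; (w19)'s additivity
`PieceAdditiveOn (analyticClass Dc.R) Dc.toC`; A3's slice-curve binders (c1)–(c3) with `0 ≤ cA`, `0 < c_dir`, `0 < ℓ`, `hhalf`;
`N j ≤ Nbar`; END-M's A1 ∕ A2 ∕ R ∕ G ∕ N binders VERBATIM.  GONE vs (w21)-MP §1: `hrespE`, `hrespA`, `hqc`, `hqcA`.  NOT PRINTED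
and not claimed: that Bałaban's (1.23) pieces, 𝐇_k, Lemma 4's curves, probes (1.20) or A^η meet these binders (O-NE9-1 ∕ O-NE9-5
∕ (w8) ∕ (w9)).  DISGUISE TEST: every coupling clause compares the SAME family at two coupling ARGUMENTS; sizes are one-history;
no joint two-history statement; the END is applied by name — not NE9.

WHAT IS PROVED (kernel, `[folklore]` bookkeeping; 0 sorry, 0 `def`).  §1 **`cpieceResponseA_cur`** (= (w21)-MP §1's `hrespA` at
the curve species, `Kp := Dc.Kp c_dir`, `gain := ℓ⁵`, `qcA := 64·cA·aA`, token for token).  §2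
**`termSize_ne9_and_fadingMemory_cur_margProj_cpieceForm_A3`**: conclusion LITERALLY (w21)-MP §1's (= END-M `…_margProj`'s) with
`qc := 64·cA·Nbar`, `qcA := 64·cA·aA`, `τbar := c_Q` — the same letters as A3-REM-END p213409.

References (TYPES only): [Balaban1987RG1] T. Bałaban, CMP **109** (1987) 249–301, (0.28)–(0.30) p. 258, (1.3) p. 260,
(1.11)–(1.14) p. 262, (1.18) p. 263, (1.20)–(1.22) p. 264, (2.12)–(2.13) p. 268, Lemma 4 (3.53)–(3.54) p. 280; [Balaban1988RG2Cluster]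
T. Bałaban, CMP **116** (1988) 1–22, (1.21)–(1.25) p. 7, (1.26)–(1.29) p. 8, (1.33)–(1.36) p. 9, Lemma 3 (2.38) p. 20.  Summits-side
NEW work (LEAN PLACEMENT RULE); imports `NE9CurveSpeciesCoupling` (this lineage), `NE9CurveSpeciesMargProj` (leaf-04-g6) and
`NE9RemainderSpeciesCouplingEnd` (leaf-09-g5) BY NAME; modifies nothing; 0 sorry.  Value = leaf A3 for the curve species
discharged on the dictionary face at FORM level, NOT summit progress.
-/

noncomputable section

namespace Summit.QuantumFields.BalabanUV.T4Continuum.NE9CurveSpeciesCouplingEnd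

open scoped BigOperators
open Metric Set
open Literature.MathematicalPhysics.QuantumFieldTheory.Balaban1983to89
open Literature.MathematicalPhysics.QuantumFieldTheory.Balaban1983to89.T4OutputRate
open Literature.MathematicalPhysics.QuantumFieldTheory.Balaban1983to89.T4HistoryLipschitzRecursion
open Literature.MathematicalPhysics.QuantumFieldTheory.Balaban1983to89.T4HistoryLipschitzOuter
open Literature.MathematicalPhysics.QuantumFieldTheory.Balaban1983to89.T4HistoryLipschitzActivity
open Literature.MathematicalPhysics.QuantumFieldTheory.Balaban1983to89.T4HistoryLipschitzActivity (ClusterGeom)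
open Literature.MathematicalPhysics.QuantumFieldTheory.Balaban1983to89.T4HistoryLipschitzSegment
open Summit.QuantumFields.BalabanUV.T4Continuum.NE9Lemma1Counting
open Summit.QuantumFields.BalabanUV.T4Continuum.NE9Lemma1Gain
open Summit.QuantumFields.BalabanUV.T4Continuum.NE9Lemma1PieceClass
open Summit.QuantumFields.BalabanUV.T4Continuum.NE9Lemma1RemainderSpecies
open Summit.QuantumFields.BalabanUV.T4Continuum.NE9Lemma1CurveSpecies
open Summit.QuantumFields.BalabanUV.T4Continuum.NE9ComplexEncoding (doubleCarriers)
open Summit.QuantumFields.BalabanUV.T4Continuum.NE9LastCouplingBridge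
open Summit.QuantumFields.BalabanUV.T4Continuum.NE9BridgeSizeInduction
open Summit.QuantumFields.BalabanUV.T4Continuum.NE9MarginalProjection
open Summit.QuantumFields.BalabanUV.T4Continuum.NE9MarginalProjectionEnd
open Summit.QuantumFields.BalabanUV.T4Continuum.NE9RemainderSpeciesMargProj (smul_mem_analyticClass projInto_margProj_analytic
  margFree_subset_analyticClass pieceBoundOnG_mono)
open Summit.QuantumFields.BalabanUV.T4Continuum.NE9CurveSpeciesMargProj
open Summit.QuantumFields.BalabanUV.T4Continuum.NE9CurveSpeciesCoupling (cpieceResponse_cur)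
open Summit.QuantumFields.BalabanUV.T4Continuum.NE9RemainderSpeciesCouplingEnd (termSize_const_smul)

variable {C₀ : Carriers} {E : Type} [NormedAddCommGroup E] [NormedSpace ℂ E] {ι α β γ δ : Type} [DecidableEq δ]

/-! ## §1 The per-piece coupling response of the marginal multiples (`hrespA`) for the curve species -/

/-- **`hrespA` FOR THE CURVE SPECIES (kernel; the producer of (w21)-MP §1's second leaf-A3 binder).**  For an ANALYTIC marginal
direction `A` ([I] (1.11)–(1.14) p. 262 — TYPE) of AW size `DirSize A κ aA`, the species' binders `CurData.Admissible`, `hhalf`, and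
this lineage's three displayed SLICE-CURVE binders — (c1) joint continuity of `(t, s′, σ′, τ) ↦ Dc.cur k s … t s′ σ′ τ` on
`(contours) × {|τ| = 1}`, (c2) coupling-Lipschitz displacement `cA·(R_X∕2)·|g k − g′ k|` and (c3) room `R_X∕2` on the inner disc
`|τ| < (2c_dir·ℓ k j)⁻¹` (TYPE [I] Lemma 4 (3.53) p. 280, [II] (1.21)–(1.23) p. 7 — asserted for nothing of Bałaban's) — the
species' piece of EVERY scale-wise multiple `U X ↦ c(scale X)·A U X` responds to the last coupling by at most
`|c(scale x)|·(Dc.Kp c_dir k y·(64·cA·aA)·(ℓ k j)⁵·e^{−κd(x)}·exp(−⅛(κ₁−1)d_k(Y) + ⅛κ₁d₀ − ½(κ₁−1)·#cubes)·|g k − g′ k|)`.  PROOF: the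
piece sourced at `x` reads the family on the creation-step slice of `x` only (`pieceLocal_cur`), where the scale-wise multiple IS
the constant multiple `c(scale x) • A`; that family is analytic (`smul_mem_analyticClass`) and of size `|c(scale x)|·aA`
(`termSize_const_smul`), so `cpieceResponse_cur` at the coupling-independent family `fun _ => c(scale x) • A` applies.
[cite: Balaban1987RG1, (1.11)-(1.14) p.262, (1.18) p.263, (3.53)-(3.54) p.280; Balaban1988RG2Cluster, (1.21)-(1.25) p.7] -/
theorem cpieceResponseA_cur {Dc : CurData C₀ E ι α β γ δ} {ℓ : ℕ → ℕ → ℝ} {cdir d0 : ℝ} (hD : Dc.Admissible ℓ cdir d0)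
    {W : Set (ℕ → ℝ)} {κ aA cA : ℝ} {A : E → (doubleCarriers C₀).Dom → ℝ}
    (hAan : A ∈ analyticClass Dc.R) (hA : DirSize A κ aA) (haA : 0 ≤ aA)
    (hcA : 0 ≤ cA) (hcdir : 0 < cdir) (hℓ : ∀ k j, 0 < ℓ k j) (hhalf : ∀ k j, cdir * ℓ k j < 1 / 2)
    (hcont : ∀ (k : ℕ) (s : ℕ → ℝ) (y : ι) (a : α) (b : β) (x : (doubleCarriers C₀).Dom),
      ContinuousOn (fun q : (ℂ × ((δ → ℝ) × (δ → ℂ))) × ℂ => Dc.cur k s y a b x q.1.1 q.1.2.1 q.1.2.2 q.2)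
        ((sphere (0:ℂ) (Dc.r k) ×ˢ {q | OnContour Dc.κ₁ (Dc.cubes k y a b) q.1 q.2}) ×ˢ sphere (0:ℂ) 1))
    (hlip : ∀ g ∈ W, ∀ g' ∈ W, ∀ (k : ℕ) (y : ι), ∀ a ∈ Dc.S0 k y, ∀ b ∈ Dc.SY k y a, ∀ (j : ℕ), ∀ x ∈ Dc.src k y a j,
      ∀ t ∈ sphere (0:ℂ) (Dc.r k), ∀ (s' : δ → ℝ) (σ' : δ → ℂ), OnContour Dc.κ₁ (Dc.cubes k y a b) s' σ' →
        ∀ τ ∈ ball (0:ℂ) (1 / (2 * (cdir * ℓ k j))),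
          ‖Dc.cur k g y a b x t s' σ' τ - Dc.cur k g' y a b x t s' σ' τ‖ ≤ cA * (Dc.R x.1 / 2) * |g k - g' k|)
    (hroom : ∀ g ∈ W, ∀ (k : ℕ) (y : ι), ∀ a ∈ Dc.S0 k y, ∀ b ∈ Dc.SY k y a, ∀ (j : ℕ), ∀ x ∈ Dc.src k y a j,
      ∀ t ∈ sphere (0:ℂ) (Dc.r k), ∀ (s' : δ → ℝ) (σ' : δ → ℂ), OnContour Dc.κ₁ (Dc.cubes k y a b) s' σ' →
        ∀ τ ∈ ball (0:ℂ) (1 / (2 * (cdir * ℓ k j))), ‖Dc.cur k g y a b x t s' σ' τ‖ ≤ Dc.R x.1 / 2) :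
    ∀ g ∈ W, ∀ g' ∈ W, ∀ (k : ℕ) (y : ι), ∀ a' ∈ Dc.toC.S0 k y, ∀ b ∈ Dc.toC.SY k y a', ∀ (j : ℕ),
      ∀ x ∈ Dc.toC.src k y a' j, ∀ c : ℕ → ℝ,
      |Dc.toC.piece k g y a' b x (fun U X => c ((doubleCarriers C₀).scale X) * A U X) -
          Dc.toC.piece k g' y a' b x (fun U X => c ((doubleCarriers C₀).scale X) * A U X)| ≤
        |c ((doubleCarriers C₀).scale x)| * (Dc.Kp cdir k y * (64 * cA * aA) * ℓ k j ^ 5 *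
          Real.exp (-(κ * (doubleCarriers C₀).d x)) *
          Real.exp (-(1 / 8) * (Dc.κ₁ - 1) * Dc.toC.dY k y + (1 / 8) * Dc.κ₁ * d0 - (1 / 2) * (Dc.κ₁ - 1) * Dc.toC.vol k y a' b) *
            |g k - g' k|) := by
  intro g hg g' hg' k y a' ha' b hb j x hx c
  -- the constant multiple read on the creation-step slice of the source
  set c₀ : ℝ := c ((doubleCarriers C₀).scale x) with hc₀
  have hloc : ∀ s : ℕ → ℝ,
      Dc.toC.piece k s y a' b x (fun U X => c ((doubleCarriers C₀).scale X) * A U X) = Dc.toC.piece k s y a' b x (c₀ • A) := by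
    intro s
    refine pieceLocal_cur Dc k s y a' b x _ _ (fun U X hX => ?_)
    simp only [Pi.smul_apply, smul_eq_mul, hc₀, hX]
  rw [hloc g, hloc g']
  -- analyticity and size of the constant multiple, as a coupling-independent family
  have hFan : ∀ g₁ ∈ W, (fun _ : ℕ → ℝ => c₀ • A) g₁ ∈ analyticClass Dc.R := fun _ _ => smul_mem_analyticClass hAan c₀
  have hT : TermSize (fun _ : ℕ → ℝ => c₀ • A) W κ (fun _ => |c₀| * aA) := termSize_const_smul hA c₀
  have hN0 : ∀ _j : ℕ, 0 ≤ |c₀| * aA := fun _ => mul_nonneg (abs_nonneg _) haA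
  have key := cpieceResponse_cur hD (Ef := fun _ : ℕ → ℝ => c₀ • A) (Nbar := |c₀| * aA) hFan hT hN0 (fun _ => le_rfl) hcA
    hcdir hℓ hhalf hcont hlip hroom g hg g' hg' k y a' ha' b hb j x hx
  calc |Dc.toC.piece k g y a' b x (c₀ • A) - Dc.toC.piece k g' y a' b x (c₀ • A)|
      ≤ Dc.Kp cdir k y * (64 * cA * (|c₀| * aA)) * ℓ k j ^ 5 * Real.exp (-(κ * (doubleCarriers C₀).d x)) *
          Real.exp (-(1 / 8) * (Dc.κ₁ - 1) * Dc.toC.dY k y + (1 / 8) * Dc.κ₁ * d0 - (1 / 2) * (Dc.κ₁ - 1) * Dc.toC.vol k y a' b) *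
            |g k - g' k| := key
    _ = |c₀| * (Dc.Kp cdir k y * (64 * cA * aA) * ℓ k j ^ 5 * Real.exp (-(κ * (doubleCarriers C₀).d x)) *
          Real.exp (-(1 / 8) * (Dc.κ₁ - 1) * Dc.toC.dY k y + (1 / 8) * Dc.κ₁ * d0 - (1 / 2) * (Dc.κ₁ - 1) * Dc.toC.vol k y a' b) *
            |g k - g' k|) := by ring

/-! ## §2 The END-M read-out face at the curve species with S-sum ∕ S5 ∕ MP ∕ A3 all by name -/

section EndFace

variable (G : ClusterGeom (doubleCarriers C₀)) {Pot : Type*} [NormedAddCommGroup Pot] [NormedSpace ℂ Pot]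

/-- **NE9 ∧ FADING MEMORY ∧ TERM SIZE ON THE v1.3 DICTIONARY AT THE CURVE SPECIES — rows MP, S-sum, S5 AND LEAF A3 DISCHARGED
(kernel end-to-end).**  leaf-04-g6's `NE9CurveSpeciesMargProj.termSize_ne9_and_fadingMemory_cur_margProj_cpieceForm` (p214225; =
END-M's read-out face at `P := Dc.toC` with MP ∕ S-sum ∕ S5 by name) APPLIED BY NAME with its two displayed leaf-A3 binders
PRODUCED: `hrespE := NE9CurveSpeciesCoupling.cpieceResponse_cur` (this lineage; `qc := 64·cA·Nbar`) and `hrespA :=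
cpieceResponseA_cur` (§1; `qcA := 64·cA·aA`).  The `TermSize E W κ N` input of `cpieceResponse_cur` is derived FIRST by END-M's own
internal route (`termSize_of_recursion_vacSub` ∘ `channelSizeNN_of_perStepNN` ∘ `channelStepSum_compProj` ∕
`channelSizeAtStepNN_compProj` ∘ `projScaleComm_margProj` ∕ `projSize_margProj`; MP's `ProjInto` := `projInto_margProj_analytic`;
S-sum ∕ S5 on the marginal-free class `{H | H ∈ analyticClass Dc.R ∧ H ∈ S ∧ ∀ j, r_j(H↾j) = 0}` from `pieceZero_cur` ∕
`pieceLocal_cur` ∕ `csrcScale_cur` ∕ `pieceBoundOnG_cur` + `pieceBoundOnG_mono`) — one-history binders only; no `TermSize`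
hypothesis; no circularity.  DISPLAYED (honest list): O1-type data; `CurData.Admissible` (Lemma 4 (3.53) TYPE: slice curves
analytic and inside the analyticity ball on the contours, ϱ > 1, gain ϱ⁻¹ ≤ c_dir·ℓ; radii; G1) and `LevelCountsG` ((1.26)–(1.28));
`Adm ⊆ analyticClass Dc.R` and S1 `AdmissibleTerms`; AW (`DirSize A κ aA`, `A ∈ analyticClass Dc.R`, `hAmul`); RO (`hrA hr0 hrs
hcr`, `hcoef`, `hnorm`) and `hS`; (w19)'s `PieceAdditiveOn (analyticClass Dc.R) Dc.toC`; leaf A3's SLICE-CURVE binders (c1)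
`hcont`, (c2) `hlip` (constant `cA ≥ 0`), (c3) `hroom`, with `hhalf`, `0 < c_dir`, `0 < ℓ k j` (TYPE [I] Lemma 4 (3.53) p. 280,
[II] (1.21)–(1.23) p. 7 — asserted for nothing of Bałaban's); `N j ≤ Nbar`; END-M's A1 ∕ A2 ∕ R ∕ G ∕ N binders VERBATIM.
GONE vs (w21)-MP §1: `hrespE`, `hrespA`, `hqc`, `hqcA`.  Conclusion = (w21)-MP §1's ∕ END-M `…_margProj`'s with
`qc := 64·cA·Nbar`, `qcA := 64·cA·aA`, `τbar := c_Q`: `qTbar = (64·cA·Nbar + cr·Nbar·(64·cA·aA))·c_Q·(1−ω)⁻¹`.  Nothing of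
[I]–[II] asserted; NE9 NOT PROVED; 0/9 unchanged. [cite: Balaban1987RG1, (0.28)-(0.30) p.258, (1.3) p.260, (1.11)-(1.14) p.262, (1.18) p.263, (1.20)-(1.22) p.264, (3.53)-(3.54) p.280; Balaban1988RG2Cluster, (1.21)-(1.29) pp.7-8, (1.33)-(1.36) p.9, Lemma 3 (2.38) p.20] -/
theorem termSize_ne9_and_fadingMemory_cur_margProj_cpieceForm_A3
    {Dc : CurData C₀ E ι α β γ δ} {ℓg : ℕ → ℕ → ℝ} {cdir d0 : ℝ}
    {Ef : Functional (doubleCarriers C₀) E} {W : Set (ℕ → ℝ)} {Adm S : Set (E → (doubleCarriers C₀).Dom → ℝ)}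
    {r : ℕ → (E → (doubleCarriers C₀).Dom → ℝ) → ℝ} {A : E → (doubleCarriers C₀).Dom → ℝ}
    {Ψ : ℕ → ℝ → (ι → ℝ) → E → (doubleCarriers C₀).Dom → ℝ} {act : ℕ → ℝ → E → Pot → G.P → ℂ} {𝒜 : ℕ → Set Pot}
    {n : ℕ → ℝ → E → G.P → ℝ} {lip clip : ℕ → ℝ} {a d : G.P → ℝ} {δv : (doubleCarriers C₀).Dom → ℝ}
    {κ O1 cQ ω cA Nbar B lipbar clipbar cr aA : ℝ} {p₀ N : ℕ → ℝ}
    (ρ : ℕ → (ι → ℝ) → Pot) (U₀ : E) (explZ : ℕ → E → (doubleCarriers C₀).Dom → ℝ) (h0 : ScaleZeroFree Ef W)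
    (hAdm : AdmissibleTerms Ef W Adm) (hres : AdmRestrict Adm)
    -- the species' binders (printed TYPE + numerals) and the analyticity of the admissible terms
    (hD : Dc.Admissible ℓg cdir d0)
    (hL : LevelCountsG Dc.toC.frame κ Dc.κ₁ O1 cQ (fun k j => ℓg k j ^ 5) (agePow ω))
    (hAdmAn : Adm ⊆ analyticClass Dc.R)
    -- crew row (w19): additivity of the (1.23)-pieces in the old term along the slice curves, on the analytic class (displayed)
    (hA16 : PieceAdditiveOn (analyticClass Dc.R) Dc.toC)
    -- the read-out and the marginal direction (END-M's RO / AW binders, verbatim) …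
    (hrA : ReadAdditive Adm r) (hr0 : ReadZero r) (hrs : ReadSize Adm r κ cr) (hA : DirSize A κ aA) (hcr : 0 ≤ cr)
    (haA : 0 ≤ aA)
    -- … and what MP needs of them at the species ((w21)-MP, verbatim)
    (hAan : A ∈ analyticClass Dc.R)
    (hAmul : ∀ c : ℕ → ℝ, (fun U X' => c ((doubleCarriers C₀).scale X') * A U X') ∈ Adm)
    (hcoef : ∀ (j : ℕ) (c : ℝ), r j (restrictScale j (c • A)) = c * r j (restrictScale j A))
    (hnorm : ∀ j : ℕ, r j (restrictScale j A) = 1 ∨ ∀ H ∈ Adm, r j (restrictScale j H) = 0)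
    (hS : ∀ H ∈ Adm, margProj r A H ∈ S)
    -- leaf A3 at the curve species: the SLICE-CURVE binders (c1)–(c3) of `cpieceResponse_cur` (displayed TYPE) and their scalars
    (hcA : 0 ≤ cA) (hcdir : 0 < cdir) (hℓpos : ∀ k j, 0 < ℓg k j) (hhalf : ∀ k j, cdir * ℓg k j < 1 / 2)
    (hcont : ∀ (k : ℕ) (s : ℕ → ℝ) (y : ι) (a' : α) (b : β) (x : (doubleCarriers C₀).Dom),
      ContinuousOn (fun q : (ℂ × ((δ → ℝ) × (δ → ℂ))) × ℂ => Dc.cur k s y a' b x q.1.1 q.1.2.1 q.1.2.2 q.2)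
        ((sphere (0:ℂ) (Dc.r k) ×ˢ {q | OnContour Dc.κ₁ (Dc.cubes k y a' b) q.1 q.2}) ×ˢ sphere (0:ℂ) 1))
    (hlip : ∀ g ∈ W, ∀ g' ∈ W, ∀ (k : ℕ) (y : ι), ∀ a' ∈ Dc.S0 k y, ∀ b ∈ Dc.SY k y a', ∀ (j : ℕ), ∀ x ∈ Dc.src k y a' j,
      ∀ t ∈ sphere (0:ℂ) (Dc.r k), ∀ (s' : δ → ℝ) (σ' : δ → ℂ), OnContour Dc.κ₁ (Dc.cubes k y a' b) s' σ' →
        ∀ τ ∈ ball (0:ℂ) (1 / (2 * (cdir * ℓg k j))),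
          ‖Dc.cur k g y a' b x t s' σ' τ - Dc.cur k g' y a' b x t s' σ' τ‖ ≤ cA * (Dc.R x.1 / 2) * |g k - g' k|)
    (hroom : ∀ g ∈ W, ∀ (k : ℕ) (y : ι), ∀ a' ∈ Dc.S0 k y, ∀ b ∈ Dc.SY k y a', ∀ (j : ℕ), ∀ x ∈ Dc.src k y a' j,
      ∀ t ∈ sphere (0:ℂ) (Dc.r k), ∀ (s' : δ → ℝ) (σ' : δ → ℂ), OnContour Dc.κ₁ (Dc.cubes k y a' b) s' σ' →
        ∀ τ ∈ ball (0:ℂ) (1 / (2 * (cdir * ℓg k j))), ‖Dc.cur k g y a' b x t s' σ' τ‖ ≤ Dc.R x.1 / 2)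
    (hO1 : 0 ≤ O1) (hcQ : 0 ≤ cQ) (hω0 : 0 ≤ ω) (hω1 : ω < 1) (hNb : ∀ j, N j ≤ Nbar)
    -- END-M's remaining binders at `T := cpieceChannel Dc.toC ∘ margProj r A`, verbatim
    (hfac : Factorises Ef W (compProj (cpieceChannel Dc.toC) (margProj r A)) Ψ) (hclip0 : ∀ k, 0 ≤ clip k)
    (hCup : ∀ g ∈ W, ∀ g' ∈ W, ∀ (k : ℕ) (U : E) (X : (doubleCarriers C₀).Dom), (doubleCarriers C₀).scale X = k + 1 →
      ∀ Q ∈ 𝒜 k, ∀ γ' ∈ G.vol X,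
      ‖act k (g k) U Q γ'‖ ≤ n k (g' k) U γ' ∧
        ‖act k (g k) U Q γ' - act k (g' k) U Q γ'‖ ≤ clip k * |g k - g' k| * n k (g' k) U γ')
    (hreprV : ∀ (k : ℕ) (s : ℝ) (Q : ι → ℝ) (U : E) (X : (doubleCarriers C₀).Dom),
      Ψ k s Q U X = (G.newTerm act k s U X (ρ k Q)).re - (G.newTerm act k s U₀ X (ρ k Q)).re + explZ k U X)
    (hclipb : ∀ k, clip k ≤ clipbar)
    (hK : TwoPointKP G W act 𝒜 n lip a d) (hdec : G.DecayExtract δv d) (hpin : G.PinBudget a δv (fun _ => B) κ)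
    (hρ : ∀ (k : ℕ) (Q Q' : ι → ℝ) (M : ℝ),
      (∀ y, |Q y - Q' y| ≤ weightOf Dc.toC.frame Dc.κ₁ d0 O1 (Dc.Kp cdir) k y * M) → ‖ρ k Q - ρ k Q'‖ ≤ M)
    (hexplZ : ∀ (k : ℕ) (U : E) (X : (doubleCarriers C₀).Dom), (doubleCarriers C₀).scale X = k + 1 →
      |explZ k U X| ≤ Real.exp (-(κ * (doubleCarriers C₀).d X)) * p₀ k)
    (hbase : ∀ g ∈ W, ∀ (U : E) (X : (doubleCarriers C₀).Dom), (doubleCarriers C₀).scale X = 0 →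
      |Ef g U X| ≤ Real.exp (-(κ * (doubleCarriers C₀).d X)) * N 0)
    (hNsucc : ∀ j, p₀ j + 2 * B ≤ N (j + 1)) (hNnn : ∀ j, 0 ≤ N j)
    (hbox : ∀ (k : ℕ) (Q : ι → ℝ),
      (∀ y, |Q y| ≤ weightOf Dc.toC.frame Dc.κ₁ d0 O1 (Dc.Kp cdir) k y *
        sizeRadius (fun k j => (1 + cr * aA) * tauOfG cQ (agePow ω) k j) N k) → ρ k Q ∈ 𝒜 k)
    (hB : 0 ≤ B) (hlipb : ∀ k, lip k ≤ lipbar) (hpos : 0 < ω + 8 * lipbar * B * ((1 + cr * aA) * cQ)) :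
    TermSize Ef W κ N ∧
      NE9 Ef W κ (prodModuli (8 * clipbar * B + 8 * lipbar * B *
          ((64 * cA * Nbar + cr * Nbar * (64 * cA * aA)) * cQ * (1 - ω)⁻¹))
        fun _ => ω + 8 * lipbar * B * ((1 + cr * aA) * cQ)) ∧
        FadingMemory ((8 * clipbar * B + 8 * lipbar * B *
              ((64 * cA * Nbar + cr * Nbar * (64 * cA * aA)) * cQ * (1 - ω)⁻¹)) /
            (ω + 8 * lipbar * B * ((1 + cr * aA) * cQ)))
          (ω + 8 * lipbar * B * ((1 + cr * aA) * cQ))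
          (prodModuli (8 * clipbar * B + 8 * lipbar * B *
              ((64 * cA * Nbar + cr * Nbar * (64 * cA * aA)) * cQ * (1 - ω)⁻¹))
            fun _ => ω + 8 * lipbar * B * ((1 + cr * aA) * cQ)) := by
  have hℓg : ∀ k j, 0 ≤ ℓg k j := fun k j => (hℓpos k j).le
  -- MP at the species and the class inclusion
  have hPinto : ProjInto Adm {H | H ∈ analyticClass Dc.R ∧ H ∈ S ∧ ∀ j, r j (restrictScale j H) = 0} (margProj r A) :=
    projInto_margProj_analytic hAdmAn hAan hAmul hrA hcoef hnorm hS
  have hMF := margFree_subset_analyticClass (E := E) Dc.R S r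
  -- S-sum / S5 on the marginal-free class from the owner's lemmas for the curve species
  have hPiece : PieceBoundOnG {H | H ∈ analyticClass Dc.R ∧ H ∈ S ∧ ∀ j, r j (restrictScale j H) = 0} Dc.toC κ Dc.κ₁ d0
      (Dc.Kp cdir) (fun k j => ℓg k j ^ 5) :=
    pieceBoundOnG_mono hMF (pieceBoundOnG_cur hD κ)
  have hcQℓ : ∀ k j, 0 ≤ cQ * agePow ω k j := fun k j => mul_nonneg hcQ (agePow_nonneg hω0 k j)
  have hsum' : ChannelStepSum {H | H ∈ analyticClass Dc.R ∧ H ∈ S ∧ ∀ j, r j (restrictScale j H) = 0}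
      (cpieceChannel Dc.toC) :=
    channelStepSum_cpiece (pieceZero_cur Dc) (pieceLocal_cur Dc) (csrcScale_cur hD) _
  have hstep' : ChannelSizeAtStepNN {H | H ∈ analyticClass Dc.R ∧ H ∈ S ∧ ∀ j, r j (restrictScale j H) = 0}
      (cpieceChannel Dc.toC) κ (weightOf Dc.toC.frame Dc.κ₁ d0 O1 (Dc.Kp cdir)) (tauOfG cQ (agePow ω)) :=
    channelSizeAtStepNN_cpieceG (pieceZero_cur Dc) (pieceLocal_cur Dc) (csrcScale_cur hD) hPiece hL (kp_nonneg hD) hO1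
      (fun k j => pow_nonneg (hℓg k j) 5) hcQℓ
  -- the size profile FIRST (END-M's own internal route; one-history binders only)
  have hPcomm : ProjScaleComm Adm (margProj r A) := projScaleComm_margProj Adm A hr0
  have hPsize : ProjSize Adm (margProj r A) κ (cr * aA) := projSize_margProj hrs hA hcr
  have hc : 0 ≤ cr * aA := mul_nonneg hcr haA
  have hT : TermSize Ef W κ N :=
    (termSize_of_recursion_vacSub G ρ U₀ explZ hAdm
      (channelSizeNN_of_perStepNN hres (channelStepSum_compProj hPcomm hPinto hsum')
        (channelSizeAtStepNN_compProj hPcomm hPinto hPsize hc hstep'))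
      hfac hK hdec hpin hreprV hexplZ hbase hNsucc hNnn hbox).1
  -- leaf A3 PRODUCED: the terms (`cpieceResponse_cur`) and the marginal multiples (§1)
  have hE : ∀ g ∈ W, Ef g ∈ analyticClass Dc.R := fun g hg => hAdmAn (hAdm.1 g hg)
  have hrespE := cpieceResponse_cur hD hE hT hNnn hNb hcA hcdir hℓpos hhalf hcont hlip hroom
  have hrespA := cpieceResponseA_cur hD (W := W) hAan hA haA hcA hcdir hℓpos hhalf hcont hlip hroom
  have hNbar : 0 ≤ Nbar := (hNnn 0).trans (hNb 0)
  have hqc : 0 ≤ 64 * cA * Nbar := by positivity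
  have hqcA : 0 ≤ 64 * cA * aA := by positivity
  exact termSize_ne9_and_fadingMemory_cur_margProj_cpieceForm G ρ U₀ explZ h0 hAdm hres hD hℓg hL hAdmAn hA16 hrA hr0 hrs hA
    hcr haA hAan hAmul hcoef hnorm hS hrespE hrespA hqc hqcA hO1 hcQ hω0 hω1 hNb hfac hclip0 hCup hreprV hclipb hK hdec hpin
    hρ hexplZ hbase hNsucc hNnn hbox hB hlipb hpos

end EndFace

end Summit.QuantumFields.BalabanUV.T4Continuum.NE9CurveSpeciesCouplingEnd

end
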